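import Literature.NumberTheory.DiophantineGeometry.GeneralizedFermatTwoPowerCoefficientFreySwanEightProofs
import Literature.NumberTheory.DiophantineGeometry.FreyCurveConductorTwoBadSignProofs
import Literature.NumberTheory.DiophantineGeometry.FreyCurveConductorTwoTwistDichotomyProofs
import Literature.NumberTheory.EllipticCurves.QuadraticTwistSwanConductorMaxProofs
import Literature.NumberTheory.EllipticCurves.QuadraticTwistTateFormTwoProofs
import Literature.NumberTheory.EllipticCurves.CuspFormLFunctionLevelConductorOfCarayolProofs
import Literature.NumberTheory.Automorphic.CDTTheorem722
import Literature.NumberTheory.Automorphic.BCDTModularity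
import HarnessLib

/-!
# stub-ideation k3 (gen 2, FAMILY 3 — probe the extremes) for `stub_threeImpTwo` (S9) of crux
`FreyModularity` (stmt-ABC-11340): the 2-adic EXTREMAL TABLE of the Frey family and the helper
lemmas that close Saito's `p = 2` leaf for EVERY Frey curve `E_(a,b)` — hence the per-instance
(3) ⇒ (2) for I1/I3 modulo Carayol 1986 only.  Statements only (sorried); recipes in
`STUB-IDEAS-stub_threeImpTwo-3.md`.
-/

noncomputable section

open scoped NumberField
open IsDedekindDomain WeierstrassCurve Rat.HeightOneSpectrum
open Literature.NumberTheory.EllipticCurves Literature.NumberTheory.EllipticCurves.ModularForms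
open Literature.NumberTheory.GaloisRepresentations Literature.NumberTheory.DiophantineGeometry
open Literature.NumberTheory.Automorphic

namespace Summit.ABC.ABC.Cruxes.FreyModularity.Sketch.ThreeImpTwoIdeas3g2

attribute [local instance] AddSubgroup.torsionBy.zmodModule

variable {A B : ℤ}

/-! ## Row "bad sign, `4 ∣ B`, `16 ∤ B`" (Kodaira `I₀*` / `I₂*`, `f₂ = 4`, `δ₂ = 2`) -/

/-- **H1 (headline) — `Sw_𝔓(E[3]) = 2` for the bad-sign additive Frey curves, by the twist-max
formula, no fake points.**  `E_(A,B) = (E_(−A,−B))^{(−1)}` (`quadraticTwist_freyCurve_neg_one`,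
`freyCurve_swap`), `E_(−A,−B)` is a good-sign curve with `Sw = 1`
(`exists_swanConductorAt_torsion_three_freyCurve_of_sixteen_not_dvd`), and `−1 ≡ 3 (mod 4)` gives
`Sw(E^{(−1)}[3]) = max (1, 2) = 2`
(`Rat.swanConductorAt_torsion_quadraticTwist_eq_max_two_of_emod_four_eq_three`, side conditions
`0 < 1`, `1 ≠ 2`).  PROVED here (recipe check of the plan; 25 lines, no class file). -/
theorem exists_swanConductorAt_torsion_three_freyCurve_badSign (h0 : A * B * (A + B) ≠ 0)
    (hA : A ≡ 1 [ZMOD 4]) (h4 : (4 : ℤ) ∣ B) (h16 : ¬ (16 : ℤ) ∣ B) :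
    ∃ 𝔓 ∈ ((primesEquiv (R := 𝓞 ℚ)).symm ⟨2, Nat.prime_two⟩).primesAbove,
      ((freyCurve A B).torsionGaloisRep 3).swanConductorAt (𝓞 ℚ) 𝔓 = 2 := by
  -- the good-sign partner
  have h0' : (-A) * (-B) * (-A + -B) ≠ 0 := by
    intro h; apply h0; nlinarith [h]
  have hA' : -A ≡ -1 [ZMOD 4] := by unfold Int.ModEq at hA ⊢; omega
  have h4' : (4 : ℤ) ∣ -B := (dvd_neg).mpr h4
  have h16' : ¬ (16 : ℤ) ∣ -B := fun h ↦ h16 ((dvd_neg).mp h)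
  obtain ⟨𝔓, h𝔓, hSw⟩ :=
    exists_swanConductorAt_torsion_three_freyCurve_of_sixteen_not_dvd h0' hA' h4' h16'
  haveI : (freyCurve (-A) (-B)).IsElliptic := isElliptic_freyCurve h0'
  have h2 : (2 : 𝓞 ℚ) ∈ ((primesEquiv (R := 𝓞 ℚ)).symm ⟨2, Nat.prime_two⟩).asIdeal := by
    have := (natCast_mem_asIdeal_iff_eq_primesEquiv_symm
      ((primesEquiv (R := 𝓞 ℚ)).symm ⟨2, Nat.prime_two⟩) Nat.prime_two).mpr rfl
    exact_mod_cast this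
  have h3 : ((3 : ℕ) : 𝓞 ℚ) ∉ ((primesEquiv (R := 𝓞 ℚ)).symm ⟨2, Nat.prime_two⟩).asIdeal := by
    intro h
    have := (natCast_mem_asIdeal_iff_eq_primesEquiv_symm
      ((primesEquiv (R := 𝓞 ℚ)).symm ⟨2, Nat.prime_two⟩) Nat.prime_three).mp h
    have := congrArg (fun v ↦ ((primesEquiv (R := 𝓞 ℚ)) v : ℕ)) this
    simp only [Equiv.apply_symm_apply] at this
    exact absurd this (by decide)
  have key := Rat.swanConductorAt_torsion_quadraticTwist_eq_max_two_of_emod_four_eq_three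
    (freyCurve (-A) (-B)) 3 (by decide) (d := -1) (by decide) h2 h3 h𝔓
    (by rw [hSw]; norm_num) (by rw [hSw]; norm_num)
  rw [hSw] at key
  have htw : (freyCurve (-A) (-B)).quadraticTwist (((-1 : ℤ) : ℚ)) = freyCurve A B := by
    rw [Int.cast_neg, Int.cast_one, quadraticTwist_freyCurve_neg_one, freyCurve_swap, neg_neg, neg_neg]
  rw [htw] at key
  refine ⟨𝔓, h𝔓, ?_⟩
  rw [key]
  norm_num

/-- **H2 — `δ₂ = 2` in the bad sign** (copy of `wildConductorExponent_freyCurve_two_eq_one` with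
`kodairaSymbolAt_freyCurve_two_of_{four,eight}_dvd_of_four_dvd_sub_one`: `I₀*`/`I₂*`, `f₂ = 4`,
`ε₂ = 2`). -/
theorem wildConductorExponent_freyCurve_two_eq_two (v : HeightOneSpectrum ℤ)
    (hv : natGenerator v = 2) (h0 : A * B * (A + B) ≠ 0) (hA : A ≡ 1 [ZMOD 4]) (h4 : (4 : ℤ) ∣ B)
    (h16 : ¬ (16 : ℤ) ∣ B) : (freyCurve A B).wildConductorExponent v = 2 := by
  sorry

/-- H2 at the place of `𝓞 ℚ` above `2` (transport `wildConductorExponent_eq_of_primesEquiv_eq`, as in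
`wildConductorExponent_freyCurve_two_eq_one_ringOfIntegers`). -/
theorem wildConductorExponent_freyCurve_two_eq_two_ringOfIntegers (v : HeightOneSpectrum (𝓞 ℚ))
    (hv : (2 : 𝓞 ℚ) ∈ v.asIdeal) (h0 : A * B * (A + B) ≠ 0) (hA : A ≡ 1 [ZMOD 4])
    (h4 : (4 : ℤ) ∣ B) (h16 : ¬ (16 : ℤ) ∣ B) : (freyCurve A B).wildConductorExponent v = 2 := by
  sorry

/-! ## Row "`2 ∥ B`" (Kodaira `III`, `f₂ = 5`, `δ₂ = 3`, either sign) -/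

/-- **H3 — `δ₂ = 3` for `2 ∥ B`, `A` odd** (`kodairaSymbolAt_freyCurve_two_of_two_dvd`: `III`,
`f₂ = 5`; `ε₂ = 2`; then transport to `𝓞 ℚ`). -/
theorem wildConductorExponent_freyCurve_two_eq_three_of_two_mul (v : HeightOneSpectrum (𝓞 ℚ))
    (hv : (2 : 𝓞 ℚ) ∈ v.asIdeal) (h0 : A * B * (A + B) ≠ 0) (hA : ¬ (2 : ℤ) ∣ A) {b : ℤ}
    (hB : B = 2 * b) (hb : ¬ (2 : ℤ) ∣ b) : (freyCurve A B).wildConductorExponent v = 3 := by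
  sorry

/-- **H4a — the second even presentation**: translating the root `−B` to the origin,
`E_(A,B) ≅ E_(A+B,−B)` (`x ↦ x − B`; cf. `translate_freyCurve`, `freyCurve_swap`).  For `2 ∥ B` it
flips the class of the odd root mod `4`. -/
theorem translate_freyCurve' (A B : ℤ) :
    (⟨1, -(B : ℚ), 0, 0⟩ : VariableChange ℚ) • freyCurve A B = freyCurve (A + B) (-B) := by
  sorry

/-- **H4 — `Sw_𝔓(E[3]) = 3` for `2 ∥ B` and EITHER sign of `A`** at some `𝔓 ∣ 2`: good sign is
`Summit.ABC.ABC.Theorems.swanConductorAt_torsion_three_freyCurve_of_two_mul`; bad sign through H4a and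
`swanConductorAt_torsion_eq_of_smul_eq` (`A + B ≡ −1 (mod 4)`, `2(A+B) + (−B) = 2A + B`). -/
theorem exists_swanConductorAt_torsion_three_freyCurve_of_two_mul' (h0 : A * B * (A + B) ≠ 0)
    (hA : ¬ (2 : ℤ) ∣ A) {b : ℤ} (hB : B = 2 * b) (hb : ¬ (2 : ℤ) ∣ b) (h2AB : 2 * A + B ≠ 0) :
    ∃ 𝔓 ∈ ((primesEquiv (R := 𝓞 ℚ)).symm ⟨2, Nat.prime_two⟩).primesAbove,
      ((freyCurve A B).torsionGaloisRep 3).swanConductorAt (𝓞 ℚ) 𝔓 = 3 := by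
  sorry

/-! ## Row "`16 ∣ B`" (semistable or its `−1`-twist `I*_{2k−4}`: `ord₂ j ≤ 0`, the `j`-engine) -/

/-- **H5 — `ord₂ j(E_(A,B)) = 8 − 2 ord₂ B ≤ 0` for `A` odd, `16 ∣ B`**, read as `1 ≤ |j|_{v₂}`:
`j = 2⁸ (A²+AB+B²)³ / (AB(A+B))²` (`j_freyCurve` / `Summit…freyCurve_j`), `A² + AB + B²` odd; then
`valuation_ratCast_eq_one_of_padicValRat_eq_zero` / `one_lt_valuation_ratCast_of_padicValRat_neg`. -/
theorem one_le_valuation_j_freyCurve_of_sixteen_dvd (h0 : A * B * (A + B) ≠ 0) (hA : ¬ (2 : ℤ) ∣ A)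
    (h16 : (16 : ℤ) ∣ B) :
    haveI := isElliptic_freyCurve h0
    1 ≤ ((primesEquiv (R := 𝓞 ℚ)).symm ⟨2, Nat.prime_two⟩).valuation ℚ (freyCurve A B).j := by
  sorry

/-! ## Assembly: Saito's `p = 2` leaf for every Frey curve -/

/-- **H6 — Saito at `2` for every even presentation** (`A` odd, `2 ∣ B`, `AB(A+B) ≠ 0`,
`2A + B ≠ 0`), every `ℓ`: the engine
`swanConductorAt_rationalTate_eq_wildConductorExponent_of_ringChar_eq_two_of_valuation_j_lt_one`
fed, row by row, with (`16 ∣ B`) H5 — hypothesis `|j|₂ < 1` absurd; (`4 ∣ B`, `16 ∤ B`, good sign)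
`exists_swanConductorAt_torsion_three_freyCurve_of_sixteen_not_dvd` + `wildConductorExponent_freyCurve_two_eq_one_ringOfIntegers`
(PROVED row); (bad sign) H1 + H2; (`2 ∥ B`) H4 + H3. -/
theorem freySaito_of_even (h0 : A * B * (A + B) ≠ 0) (hA : ¬ (2 : ℤ) ∣ A) (h2 : (2 : ℤ) ∣ B)
    (h2AB : 2 * A + B ≠ 0) (ℓ : ℕ) [Fact ℓ.Prime] :
    (freyCurve A B).swanConductorAt_rationalTate_eq_wildConductorExponent_of_ringChar_eq_two ℓ := by
  sorry

/-- **H7a — the named Saito leaf is an isomorphism invariant** (`swanConductorAt_rationalTate_eq_of_smul_eq`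
+ `wildConductorExponent_smul'`, as inlined in `OggFormulaJZeroTwoProofs`). -/
theorem saitoTwo_of_smul_eq {W W' : WeierstrassCurve ℚ} [W.IsElliptic] {C : VariableChange ℚ}
    (e : C • W = W') (ℓ : ℕ) [Fact ℓ.Prime]
    (h : W'.swanConductorAt_rationalTate_eq_wildConductorExponent_of_ringChar_eq_two ℓ) :
    W.swanConductorAt_rationalTate_eq_wildConductorExponent_of_ringChar_eq_two ℓ := by
  sorry

/-- **H7 (= gen-1 H5 `freySaito`, now assembled) — Saito's `p = 2` leaf for EVERY Frey curve.**
Presentations: `b` even → H6 verbatim; `a` even → `freyCurve a b = freyCurve (−b) (−a)`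
(`freyCurve_swap b a`, an equation); `a, b` odd → `translate_freyCurve a b` + H7a.  The corner
`2A + B = 0` (`E_(±1,∓2) ≅ y² = x³ − x`, `j = 1728`, class `(6,4,≥8)`, `c₄' = 3`) is the same class
theorem `…D6C4Cge8M8R3` (or `…_of_j1728_model`, `a = −1`, `δ = 3`). -/
theorem freySaito (a b : ℤ) (hab : IsCoprime a b) (h0 : a * b * (a + b) ≠ 0) (ℓ : ℕ) [Fact ℓ.Prime] :
    (freyCurve a b).swanConductorAt_rationalTate_eq_wildConductorExponent_of_ringChar_eq_two ℓ := by
  sorry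

/-- **Per-instance S9 for I1/I3 (every Frey curve), modulo the Carayol-1986 Galois-form fact and a
"some-level newform" source** — here phrased over the tree adapter
`IsNewformOf.level_eq_conductorNorm_of_carayol1986_of_saito`: whatever produces a newform `f` of SOME
level with `IsNewformOf (freyCurve a b) f` from `IsModularGaloisRepTate ℓ` (k1's
`exists_isNewformOf_of_isModularGaloisRepTate_of_deligne_of_carayolEuler hD hCE`, PROVED; or `hES₀`)
lands at level `N_E` by H7. -/
theorem threeImpTwo_freyCurve (hCA : Carayol1986_artinConductorExponent)
    (hSome : ∀ (W : WeierstrassCurve ℚ) [W.IsElliptic] (ℓ : ℕ) [Fact ℓ.Prime],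
      W.IsModularGaloisRepTate ℓ →
        ∃ (N : ℕ) (_ : NeZero N) (f : CuspForm (CongruenceSubgroup.Gamma0 N) 2), IsNewformOf W f)
    (a b : ℤ) (hab : IsCoprime a b) (h0 : a * b * (a + b) ≠ 0)
    [NeZero ((freyCurve a b).conductorNorm ℤ)] (ℓ : ℕ) [Fact ℓ.Prime]
    (h : haveI := isElliptic_freyCurve h0; (freyCurve a b).IsModularGaloisRepTate ℓ) :
    haveI := isElliptic_freyCurve h0; BCDT.IsModular (freyCurve a b) := by
  haveI := isElliptic_freyCurve h0
  obtain ⟨N, hN, f, hf⟩ := hSome (freyCurve a b) ℓ h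
  have hNE : N = (freyCurve a b).conductorNorm ℤ :=
    hf.level_eq_conductorNorm_of_carayol1986_of_saito hCA (freySaito a b hab h0)
  subst hNE
  exact ⟨f, hf⟩

end Summit.ABC.ABC.Cruxes.FreyModularity.Sketch.ThreeImpTwoIdeas3g2

end
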